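import Summits.ResolutionOfSingularities.ResolutionOfSingularities.Theorems.WeightedInvariantWeightedConstructionStaticDefs
import Summits.ResolutionOfSingularities.ResolutionOfSingularities.Theorems.WeightedInvariantWeightedConstructionCobordantPlusSmoothOfRegular
import Summits.ResolutionOfSingularities.ResolutionOfSingularities.Theorems.WeightedInvariantWeightedConstructionExtReesWeighted
import Summits.ResolutionOfSingularities.ResolutionOfSingularities.Theorems.WeightedInvariantWeightedConstructionCobordantBlowupRegular
import Literature.AlgebraicGeometry.Resolution.CobordantBlowupRegular
import Literature.AlgebraicGeometry.Resolution.CobordantBlowupRegularCentre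
import Literature.AlgebraicGeometry.Resolution.IdealSheafLemmas
import Mathlib.RingTheory.RegularLocalRing.Polynomial
import Mathlib.AlgebraicGeometry.IdealSheaf.Functorial
import Mathlib.AlgebraicGeometry.Morphisms.Smooth
import Mathlib.AlgebraicGeometry.Morphisms.ClosedImmersion
import HarnessLib

/-!
# The exceptional divisor `E(U) → Spec k` of a cobordant chart is smooth

Route `ResolutionOfSingularities/WeightedInvariant`, crux `WeightedConstruction`
(stmt-ResolutionOfSingularities-0571), line `no-phi-rays-static-drop`, stub
`stub_exceptional_smooth`.

For a Rees algebra `R` on a smooth separated quasi-compact scheme `Y` over a perfect field `k`,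
presented on the affine chart `U` by a weighted chart `(u, w)` (`ReesAlgebraData.IsWeightedChart`),
the exceptional divisor `E(U) = V(t⁻¹) ∩ B₊(U)` of the cobordant blow-up
(`cobordantExceptional R U`, an ideal sheaf on `B₊(U) = R.cobordantPlus U`) is smooth over `k`:

* `A := Γ(Y, U)` is a regular ring (`Y` is smooth over a field, hence regular and locally
  Noetherian) and the chart's parameters are part of a regular system of parameters at the points of
  `V(u)`, so `A/(u)` is a regular ring and `u` is weighted quasi-regular
  (`CobordantBlowupRegularCentre.lean`); by Włodarczyk's Lemma 4.1.5 / §2.3.9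
  (`cobordantAlgebra.nonempty_quotient_span_s_equiv`) the exceptional fibre ring
  `A[t⁻¹, uᵢ t^{wᵢ}]/(t⁻¹) ≅ (A/(u))[X₁, …, Xₘ]` is a polynomial ring over a regular ring, hence
  regular (`isRegularRing_cobordantAlgebra_quotient_span_s_of_isWeightedChart`);
* the chart identifies `Γ(U)[t⁻¹, Rₙ(U) tⁿ]` with `A[t⁻¹, uᵢ t^{wᵢ}]`
  (`stub_extReesAlgebra_weighted`) and `t⁻¹` with `s`, so `Γ(U)[t⁻¹, Rₙ(U) tⁿ]/(t⁻¹)` is regular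
  (`isRegularRing_extReesAlgebra_quotient_of_eq`);
* the closed subscheme `V(t⁻¹) ⊆ B(U) = Spec Γ(U)[t⁻¹, Rₙ(U) tⁿ]` is the spectrum of that quotient
  (Mathlib's `Scheme.IdealSheafData.subschemeCover` over the affine open `⊤`), hence a regular
  scheme (`isRegular_subscheme_exceptional`), and `E(U)`, its restriction to the open `B₊(U)`
  (`Scheme.IdealSheafData.comapIso`), is an open subscheme of it, hence regular;
* `E(U) → B₊(U) → Y → Spec k` is locally of finite type (a closed immersion followed by the smooth
  structure morphism), so it is smooth (`smooth_of_isRegular_of_perfectField`).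

Source: J. Włodarczyk, *Functorial resolution by torus actions*, arXiv:2203.03090, §2.3.9 and
Lemma 4.1.5. [Wlodarczyk2022]
-/

noncomputable section

open CategoryTheory CategoryTheory.Limits AlgebraicGeometry TopologicalSpace
open Literature.AlgebraicGeometry.Resolution
open scoped LaurentPolynomial

set_option linter.dupNamespace false -- mandated namespace of this single-conjunct summit

namespace Summit.ResolutionOfSingularities.ResolutionOfSingularities.Theorems

universe u

/-! ## The exceptional fibre ring of a weighted chart is regular -/

/-- **Włodarczyk Lemma 4.1.5 / §2.3.9 on a weighted chart**: on a regular locally Noetherian scheme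
`Y`, for a weighted chart `(W, u, w)` of a Rees algebra `R` the exceptional fibre ring
`Γ(Y, W)[t⁻¹, uᵢ t^{wᵢ}]/(t⁻¹)` of the full cobordant blow-up is a regular ring: it is the
polynomial ring `(Γ(Y, W)/(u))[X₁, …, Xₘ]` (`cobordantAlgebra.nonempty_quotient_span_s_equiv`) over
the regular ring `Γ(Y, W)/(u)` — the parameters being part of a regular system of parameters of the
stalks `𝒪_{Y,y}` at the points `y` of `V(u)`, which are localisations of `Γ(Y, W)` at the primes
`P ⊇ (u)`. [cite: Wlodarczyk2022, §2.3.9 and Lemma 4.1.5] -/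
theorem isRegularRing_cobordantAlgebra_quotient_span_s_of_isWeightedChart {Y : Scheme.{u}}
    [IsLocallyNoetherian Y] (hY : Scheme.IsRegular Y) {R : ReesAlgebraData Y} {W : Y.affineOpens}
    {m : ℕ} {u : Fin m → Γ(Y, W)} {w : Fin m → ℕ} (h : R.IsWeightedChart W u w) :
    IsRegularRing (cobordantAlgebra u w ⧸ Ideal.span {cobordantAlgebra.s u w}) := by
  classical
  haveI : IsRegularRing Γ(Y, W) := hY.isRegularRing_of_isAffineOpen W.2
  -- the chart's linear independence, read in the stalks of `Y` at the points of `V(u) ∩ W`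
  have hloc : ∀ (P : Ideal Γ(Y, W)) [P.IsPrime], Ideal.span (Set.range u) ≤ P →
      ∃ (S : Type u) (_ : CommRing S) (_ : Algebra Γ(Y, W) S) (_ : IsLocalization.AtPrime S P)
        (_ : IsRegularLocalRing S)
        (hmem : ∀ i, algebraMap Γ(Y, W) S (u i) ∈ IsLocalRing.maximalIdeal S),
        LinearIndependent (IsLocalRing.ResidueField S)
          fun i => (IsLocalRing.maximalIdeal S).toCotangent
            ⟨algebraMap Γ(Y, W) S (u i), hmem i⟩ := by
    intro P _ hP
    let p : PrimeSpectrum Γ(Y, W) := ⟨P, ‹_›⟩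
    have hy : W.2.fromSpec p ∈ (W : Y.Opens) := by
      rw [← SetLike.mem_coe, ← W.2.range_fromSpec]
      exact ⟨p, rfl⟩
    letI : Algebra Γ(Y, W) (Y.presheaf.stalk (W.2.fromSpec p)) :=
      TopCat.Presheaf.algebra_section_stalk Y.presheaf ⟨W.2.fromSpec p, hy⟩
    haveI : IsLocalization.AtPrime (Y.presheaf.stalk (W.2.fromSpec p)) P :=
      W.2.isLocalization_stalk' p hy
    haveI : IsRegularLocalRing (Y.presheaf.stalk (W.2.fromSpec p)) := hY _
    have hmem : ∀ i, algebraMap Γ(Y, W) (Y.presheaf.stalk (W.2.fromSpec p)) (u i) ∈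
        IsLocalRing.maximalIdeal _ := fun i =>
      (IsLocalization.AtPrime.to_map_mem_maximal_iff (Y.presheaf.stalk (W.2.fromSpec p)) P
        (u i)).mpr (hP (Ideal.subset_span ⟨i, rfl⟩))
    exact ⟨Y.presheaf.stalk (W.2.fromSpec p), inferInstance, inferInstance, inferInstance,
      inferInstance, hmem, h.linearIndependent _ hy hmem⟩
  -- `Γ(Y, W)/(u)` is a regular ring
  haveI : IsRegularRing (Γ(Y, W) ⧸ Ideal.span (Set.range u)) := by
    refine isRegularRing_quotient_of_localization (Ideal.span (Set.range u)) fun P _ hP => ?_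
    obtain ⟨S, _, _, _, _, hmem, hli⟩ := hloc P hP
    refine ⟨S, inferInstance, inferInstance, inferInstance, ?_⟩
    rw [Ideal.map_span, ← Set.range_comp]
    exact isRegularLocalRing_quotient_span_range _ hmem hli
  -- `u` is weighted quasi-regular
  have hwqr : ∀ (n : ℕ) (P : MvPolynomial (Fin m) Γ(Y, W)), P.IsWeightedHomogeneous w n →
      MvPolynomial.eval u P ∈ (weightedFiltration u w).ideal (n + 1) →
        ∀ β, P.coeff β ∈ Ideal.span (Set.range u) := by
    refine weightedQuasiRegular_of_localization u w fun 𝔪 _ h𝔪 => ?_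
    obtain ⟨S, _, _, _, _, hmem, hli⟩ := hloc 𝔪 h𝔪
    exact ⟨S, inferInstance, inferInstance, inferInstance,
      weightedQuasiRegular_of_linearIndependent_toCotangent _ w h.w_pos hmem hli⟩
  -- Lemma 4.1.5: `𝒪_B/(s) ≅ (A/(u))[X]`, a polynomial ring over a regular ring
  obtain ⟨e⟩ := cobordantAlgebra.nonempty_quotient_span_s_equiv u w h.w_pos hwqr
  exact IsRegularRing.of_ringEquiv e.symm

/-- On a weighted chart the extended Rees algebra `A[t⁻¹, Iₙ tⁿ]` of the pieces
`Iₙ = (u^α : Σ wᵢ αᵢ ≥ n)` is `A[t⁻¹, uᵢ t^{wᵢ}]` (`stub_extReesAlgebra_weighted`) with `t⁻¹ = s`,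
so its exceptional fibre ring `A[t⁻¹, Iₙ tⁿ]/(t⁻¹)` is regular as soon as `A[t⁻¹, uᵢ t^{wᵢ}]/(s)`
is.
[folklore] -/
theorem isRegularRing_extReesAlgebra_quotient_of_eq {A : Type} [CommRing A] {I : ℕ → Ideal A}
    {m : ℕ} {u : Fin m → A} {w : Fin m → ℕ} (hI : I = weightedMonomialIdeal u w)
    [hreg : IsRegularRing (cobordantAlgebra u w ⧸ Ideal.span {cobordantAlgebra.s u w})] :
    IsRegularRing (extReesAlgebra I ⧸ Ideal.span {extReesAlgebra.tInv I}) := by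
  subst hI
  -- the `A`-isomorphism `A[t⁻¹, Iₙ tⁿ] ≅ A[t⁻¹, uᵢ t^{wᵢ}]` of equal subalgebras of `A[t, t⁻¹]`
  let e : cobordantAlgebra u w ≃ₐ[A] extReesAlgebra (weightedMonomialIdeal u w) :=
    Subalgebra.equivOfEq _ _ (stub_extReesAlgebra_weighted u w).symm
  have hs : e (cobordantAlgebra.s u w) = extReesAlgebra.tInv (weightedMonomialIdeal u w) :=
    Subtype.ext rfl
  have hmap : Ideal.span {extReesAlgebra.tInv (weightedMonomialIdeal u w)} =
      (Ideal.span {cobordantAlgebra.s u w}).map (e.toRingEquiv : _ →+* _) := by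
    rw [Ideal.map_span, Set.image_singleton]
    exact congrArg (fun x => Ideal.span {x}) hs.symm
  have e' : (cobordantAlgebra u w ⧸ Ideal.span {cobordantAlgebra.s u w}) ≃+*
      (extReesAlgebra (weightedMonomialIdeal u w) ⧸
        Ideal.span {extReesAlgebra.tInv (weightedMonomialIdeal u w)}) :=
    Ideal.quotientEquiv _ _ e.toRingEquiv hmap
  exact IsRegularRing.of_ringEquiv
    (R := cobordantAlgebra u w ⧸ Ideal.span {cobordantAlgebra.s u w}) e'

/-! ## The closed subscheme `V(t⁻¹)` of the full cobordant blow-up is regular -/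

/-- **`V(t⁻¹) ⊆ B = Spec A[t⁻¹, Iₙ tⁿ]` is a regular scheme when `A[t⁻¹, Iₙ tⁿ]/(t⁻¹)` is a
regular ring**: the closed subscheme of the ideal sheaf of `(t⁻¹)` (Mathlib's
`Scheme.IdealSheafData.subscheme`) is covered by its single affine piece over `⊤`
(`Scheme.IdealSheafData.subschemeCover`), the spectrum of `Γ(B, ⊤)/(t⁻¹) ≅ A[t⁻¹, Iₙ tⁿ]/(t⁻¹)`.
[folklore] -/
theorem isRegular_subscheme_exceptional {A : Type u} [CommRing A] (I : ℕ → Ideal A)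
    [hreg : IsRegularRing (extReesAlgebra I ⧸ Ideal.span {extReesAlgebra.tInv I})] :
    Scheme.IsRegular (affineCobordantBlowup.exceptional I).subscheme := by
  -- notation
  let S := extReesAlgebra I
  haveI : IsAffine (affineCobordantBlowup I) := (inferInstance : IsAffine (Spec (.of S)))
  let E : (affineCobordantBlowup I).IdealSheafData := affineCobordantBlowup.exceptional I
  let V : (affineCobordantBlowup I).affineOpens := ⟨⊤, isAffineOpen_top _⟩
  let ε : Γ(affineCobordantBlowup I, ⊤) ≅ CommRingCat.of S := Scheme.ΓSpecIso (.of S)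
  -- the top ideal of the exceptional ideal sheaf is `(t⁻¹)`, transported through `ΓSpecIso`
  have hideal : E.ideal V = (Ideal.span {extReesAlgebra.tInv I}).map ε.inv.hom :=
    ideal_ofIdealTop_top (X := affineCobordantBlowup I) _
  -- so `Γ(B, ⊤)/E(⊤) ≅ S/(t⁻¹)` is a regular ring
  haveI hregV : IsRegularRing (Γ(affineCobordantBlowup I, (V : (affineCobordantBlowup I).Opens)) ⧸
      E.ideal V) := by
    have hmap : E.ideal V =
        (Ideal.span {extReesAlgebra.tInv I}).map (ε.commRingCatIsoToRingEquiv.symm : S →+* _) := by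
      rw [hideal]
      rfl
    have e' : (S ⧸ Ideal.span {extReesAlgebra.tInv I}) ≃+*
        (Γ(affineCobordantBlowup I, (V : (affineCobordantBlowup I).Opens)) ⧸ E.ideal V) :=
      Ideal.quotientEquiv _ _ ε.commRingCatIsoToRingEquiv.symm hmap
    exact IsRegularRing.of_ringEquiv (R := S ⧸ Ideal.span {extReesAlgebra.tInv I}) e'
  have hregSpec : Scheme.IsRegular (Spec (E.subschemeCover.X V)) :=
    Scheme.isRegular_Spec (.of (Γ(affineCobordantBlowup I, (V : (affineCobordantBlowup I).Opens)) ⧸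
      E.ideal V))
  refine Scheme.IsRegular.of_forall_exists_isOpenImmersion fun x => ?_
  refine ⟨_, E.subschemeCover.f V, inferInstance, ?_, hregSpec⟩
  rw [← Scheme.Hom.coe_opensRange, Scheme.IdealSheafData.opensRange_subschemeCover_map]
  exact trivial

/-! ## The stub -/

/-- **The exceptional divisor `E(U) → Spec k` of a cobordant chart is smooth** (registered stub
`stub_exceptional_smooth` of line `no-phi-rays-static-drop`): for a Rees algebra presented by a
weighted chart `(u, w)` on the affine open `U` of a smooth separated quasi-compact `Y` over a
perfect field, with `B₊(U) → Spec k` smooth, the exceptional divisor `E(U) → Spec k` is smooth —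
`E(U)` is an open subscheme of `V(t⁻¹) ⊆ B(U)`, the spectrum of the polynomial ring
`(Γ(U)/(u))[u']` over the regular ring `Γ(U)/(u)` (Włodarczyk 2.3.9 / Lemma 4.1.5), hence regular,
and it is locally of finite type over the perfect field `k`, hence smooth
(`smooth_of_isRegular_of_perfectField`).
[cite: Wlodarczyk2022, §2.3.9 and Lemma 4.1.5] -/
theorem stub_exceptional_smooth :
    ∀ ⦃k : Type⦄ [Field k] [PerfectField k] ⦃Y : Scheme.{0}⦄ (f : Y ⟶ Spec (.of k)) [Smooth f]
      [IsSeparated f] [QuasiCompact f] (R : ReesAlgebraData Y) (U : Y.affineOpens),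
      (∃ (m : ℕ) (u : Fin m → Γ(Y, U)) (w : Fin m → ℕ), R.IsWeightedChart U u w) →
      Smooth (R.cobordantPlusι U ≫ f) →
      Smooth ((cobordantExceptional R U).subschemeι ≫ R.cobordantPlusι U ≫ f) := by
  intro k _ _ Y f _ _ _ R U hchart hsm
  obtain ⟨m, u, w, hc⟩ := hchart
  -- `Y` is regular and locally Noetherian
  haveI : IsLocallyNoetherian Y := LocallyOfFiniteType.isLocallyNoetherian f
  have hY : Scheme.IsRegular Y := fun y => isRegularLocalRing_stalk_of_smooth_of_field f y
  -- the exceptional fibre ring of the chart is regular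
  have hI : R.chartIdeals U = weightedMonomialIdeal u w := funext fun n => hc.ideal_eq n
  haveI := isRegularRing_cobordantAlgebra_quotient_span_s_of_isWeightedChart hY hc
  haveI := isRegularRing_extReesAlgebra_quotient_of_eq hI
  -- `V(t⁻¹) ⊆ B(U)` is regular, and `E(U)` is an open subscheme of it
  have hExc : Scheme.IsRegular (affineCobordantBlowup.exceptional (R.chartIdeals U)).subscheme :=
    isRegular_subscheme_exceptional (R.chartIdeals U)
  have hE : Scheme.IsRegular (cobordantExceptional R U).subscheme :=
    hExc.of_isOpenImmersion
      (((affineCobordantBlowup.exceptional (R.chartIdeals U)).comapIso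
          (affineCobordantBlowup.plusOpens (R.chartIdeals U)).ι).hom ≫
        pullback.snd (affineCobordantBlowup.plusOpens (R.chartIdeals U)).ι
          (affineCobordantBlowup.exceptional (R.chartIdeals U)).subschemeι)
  -- `E(U) → B₊(U) → Y → Spec k` is locally of finite type
  haveI := hsm
  haveI : LocallyOfFiniteType ((cobordantExceptional R U).subschemeι ≫ R.cobordantPlusι U ≫ f) :=
    MorphismProperty.comp_mem @LocallyOfFiniteType _ _ inferInstance inferInstance
  exact smooth_of_isRegular_of_perfectField _ hE

end Summit.ResolutionOfSingularities.ResolutionOfSingularities.Theorems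

end
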